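import Literature.Topology.FourManifolds.TorusCurveTubes
import Mathlib.Analysis.SpecialFunctions.SmoothTransition
import Mathlib.Analysis.SpecialFunctions.Complex.Circle
import Mathlib.Analysis.SpecialFunctions.Trigonometric.ArctanDeriv
import HarnessLib

/-!
# The braided torus `T_β ⊂ T² × T²` with flat spots, and its tube

Topic `Literature/Topology/FourManifolds` (fact seat of the Seiberg–Witten leaf
`Literature.Barriers.SmoothPoincare4.akhmedovPark2010_lemma8_invariants`; block 2 of
Akhmedov–Park's `X₁(m)`, A. Akhmedov, B. D. Park, Invent. Math. 181 (2010), §3 and §5 eq. (5.1)):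
"`T_β ⊂ (D² × S¹) × S¹ ⊂ T⁴`", the closed connected 2-string braid `β` times a circle, a torus in
the class `2[α₃ × α₄]` meeting the torus `α₁ × α₂ = T² × {y₀}` transversally in two points, at
which `Σ̄₂` is produced by one resolution and one blow-up.  In the tree's smooth model
`e : X ≃ (T × S¹) × S¹` of `T × T²` (`T = Rechart f₂ (S¹ × S¹)` the first torus, fibre tube of
`T × {(1, 1)}` with `e (T₁ (p, v)) = ((p, exp(i arctan v₀)), exp(i arctan v₁))`,
`exists_surface_prod_torus_smooth_model`) this file constructs `T_β` PARAMETRISED BY THE TORUS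
`T` ITSELF, `(σ, τ) = out w`:

  `S₂ w = e⁻¹ ((η σ, σ²), τ)`,  `η σ = into (x₀₁ · exp(i r₀ Re κ σ), x₀₂ · exp(i r₀ Im κ σ))`,

a small loop `η` about `x₀` in the first torus (the disc factor `D²` of the braid), the braid
direction `σ ↦ σ²` (two strings), times the circle `τ`; here `κ σ = (Re σ + i Im σ · B (Re σ))/‖…‖`
for the even plateau `B a = S (3 - 4a) S (3 + 4a)` (`S` the smooth transition; `B = 1` for
`|a| ≤ 1/2`, `B = 0` for `|a| ≥ 3/4`) is an ODD smooth unit complex function with two FLAT SPOTS,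
`κ = 1` for `Re σ ≥ 3/4` and `κ = -1` for `Re σ ≤ -3/4`, so that near its two intersection points
with `T × {(1, 1)}` (`σ = ±1`, `τ = 1`) the torus `S₂` is exactly `{x₂} × T²`, `{x₃} × T²`
(`x₂ = η 1`, `x₃ = η (-1)`): the plumbing normal form used by the local models
`DoublePointResolutionNeck.lean`, `BlowUpLineCapTube.lean`.  With its tube

  `T₂ (w, v) = e⁻¹ ((into ((out (η σ)) · (exp(i δ arctan(v₀)/2), exp(i δ arctan(v₁)/2))), σ²), τ)`

(translation in the first torus by THIN quarter arcs, `δ ≤ r₀/5`, so that the tubes about the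
two strings over one point of the braid axis — at `σ` and `-σ`, `2 r₀`-apart in angle — are
disjoint), everything is proved; no definitions, no named facts (the maps are bound by
hypotheses `hθ : ∀ σ, θ σ = …`, `hG : ∀ w v, G (w, v) = …`):

* §1 the plateau, `κ` (unit, odd, flat spots, smooth) and the loop;
* §2 `G (w, v) = ((into (θ σ · A v), σ²), τ)` is smooth, injective (`injective_braidMap`) and open
  (`isOpenMap_braidMap`; the squaring map of the circle is open, `isOpenMap_circle_sq`);
* §3 `isSmoothEmbedding_braidedTorusTube` — **`T₂ = e⁻¹ ∘ G` is a smooth embedding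
  `T × ℝ² → X` with open range** (smooth left inverse on the range patched from the local
  inverses `σ = σ₀ · exp(i arg(y₁ σ̄₀²)/2)`, Lee Prop. 5.2), together with the facts consumed by the
  assembly of `Σ̄₂`: the `T²`-coordinates of `T₂ (w, v)` are `(σ², τ)`; the flat spots; and
  `Re σ² > 1/8 → |Re σ| > 3/4`.

## References

* A. Akhmedov, B. D. Park, Invent. Math. 181 (2010) 577–603 = arXiv:math/0701829, §3 and §5
  eq. (5.1). [AkhmedovPark2010]
* J. M. Lee, *Introduction to Smooth Manifolds*, 2nd ed. (2013), Prop. 5.2. [LeeSmoothManifolds2013]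
-/

noncomputable section

open scoped Manifold ContDiff Topology Real ComplexConjugate
open Set Function Complex
open Literature.Geometry.Manifold (Rechart)

namespace Literature.Topology.FourManifolds

namespace BraidedTorus

/-! ### §1 The plateau `B`, the flat-spotted odd unit map `κ`, the loop `θ` -/

section Kappa

/-- The plateau: `B a = S (3 - 4a) S (3 + 4a)` is `1` for `|a| ≤ 1/2`. [folklore] -/
theorem plateau_eq_one {a : ℝ} (ha : |a| ≤ 1 / 2) :
    Real.smoothTransition (3 - 4 * a) * Real.smoothTransition (3 + 4 * a) = 1 := by
  obtain ⟨h1, h2⟩ := abs_le.1 ha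
  rw [Real.smoothTransition.one_of_one_le (by linarith),
    Real.smoothTransition.one_of_one_le (by linarith), mul_one]

/-- The plateau vanishes for `a ≥ 3/4`. [folklore] -/
theorem plateau_eq_zero_of_ge {a : ℝ} (ha : 3 / 4 ≤ a) :
    Real.smoothTransition (3 - 4 * a) * Real.smoothTransition (3 + 4 * a) = 0 := by
  rw [Real.smoothTransition.zero_of_nonpos (by linarith), zero_mul]

/-- The plateau vanishes for `a ≤ -3/4`. [folklore] -/
theorem plateau_eq_zero_of_le {a : ℝ} (ha : a ≤ -(3 / 4)) :
    Real.smoothTransition (3 - 4 * a) * Real.smoothTransition (3 + 4 * a) = 0 := by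
  rw [Real.smoothTransition.zero_of_nonpos (by linarith : 3 + 4 * a ≤ 0), mul_zero]

/-- The plateau is even. [folklore] -/
theorem plateau_neg (a : ℝ) :
    Real.smoothTransition (3 - 4 * -a) * Real.smoothTransition (3 + 4 * -a) =
      Real.smoothTransition (3 - 4 * a) * Real.smoothTransition (3 + 4 * a) := by
  rw [mul_comm]; ring_nf

/-- `0 ≤ B ≤ 1`. [folklore] -/
theorem plateau_mem (a : ℝ) :
    0 ≤ Real.smoothTransition (3 - 4 * a) * Real.smoothTransition (3 + 4 * a) ∧
      Real.smoothTransition (3 - 4 * a) * Real.smoothTransition (3 + 4 * a) ≤ 1 :=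
  ⟨mul_nonneg (Real.smoothTransition.nonneg _) (Real.smoothTransition.nonneg _),
    mul_le_one₀ (Real.smoothTransition.le_one _) (Real.smoothTransition.nonneg _)
      (Real.smoothTransition.le_one _)⟩

/-- The plateau is smooth. [folklore] -/
theorem contDiff_plateau :
    ContDiff ℝ ∞ fun a : ℝ => Real.smoothTransition (3 - 4 * a) * Real.smoothTransition (3 + 4 * a) :=
  (Real.smoothTransition.contDiff.comp (contDiff_const.sub (contDiff_const.mul contDiff_id))).mul
    (Real.smoothTransition.contDiff.comp (contDiff_const.add (contDiff_const.mul contDiff_id)))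

/-- **The raw vector `Re σ + i Im σ B (Re σ)` of a unit complex number is nonzero** (if `Re σ = 0`
then `|Im σ| = 1` and `B 0 = 1`). [folklore] -/
theorem raw_ne_zero {σ : ℂ} (hσ : ‖σ‖ = 1) :
    (σ.re : ℂ) + ((σ.im * (Real.smoothTransition (3 - 4 * σ.re) *
      Real.smoothTransition (3 + 4 * σ.re)) : ℝ) : ℂ) * I ≠ 0 := by
  intro h
  have hre : σ.re = 0 := by simpa using congrArg Complex.re h
  have him : σ.im * (Real.smoothTransition (3 - 4 * σ.re) * Real.smoothTransition (3 + 4 * σ.re)) = 0 := by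
    simpa using congrArg Complex.im h
  rw [hre] at him
  have h0 : Real.smoothTransition (3 - 4 * (0 : ℝ)) * Real.smoothTransition (3 + 4 * (0 : ℝ)) = 1 :=
    plateau_eq_one (by norm_num)
  rw [h0, mul_one] at him
  have : ‖σ‖ ^ 2 = σ.re ^ 2 + σ.im ^ 2 := by
    rw [← Complex.normSq_eq_norm_sq, Complex.normSq_apply]; ring
  rw [hσ, hre, him] at this
  norm_num at this

/-- On the flat spot `Re σ ≥ 3/4` the raw vector is the positive real `Re σ`. [folklore] -/
theorem raw_eq_of_re_ge {σ : ℂ} (hσ : 3 / 4 ≤ σ.re) :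
    (σ.re : ℂ) + ((σ.im * (Real.smoothTransition (3 - 4 * σ.re) *
      Real.smoothTransition (3 + 4 * σ.re)) : ℝ) : ℂ) * I = (σ.re : ℂ) := by
  rw [plateau_eq_zero_of_ge hσ, mul_zero, Complex.ofReal_zero, zero_mul, add_zero]

/-- On the flat spot `Re σ ≤ -3/4` the raw vector is the negative real `Re σ`. [folklore] -/
theorem raw_eq_of_re_le {σ : ℂ} (hσ : σ.re ≤ -(3 / 4)) :
    (σ.re : ℂ) + ((σ.im * (Real.smoothTransition (3 - 4 * σ.re) *
      Real.smoothTransition (3 + 4 * σ.re)) : ℝ) : ℂ) * I = (σ.re : ℂ) := by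
  rw [plateau_eq_zero_of_le hσ, mul_zero, Complex.ofReal_zero, zero_mul, add_zero]

/-- The raw vector is odd. [folklore] -/
theorem raw_neg (σ : ℂ) :
    ((-σ).re : ℂ) + (((-σ).im * (Real.smoothTransition (3 - 4 * (-σ).re) *
      Real.smoothTransition (3 + 4 * (-σ).re)) : ℝ) : ℂ) * I =
    -((σ.re : ℂ) + ((σ.im * (Real.smoothTransition (3 - 4 * σ.re) *
      Real.smoothTransition (3 + 4 * σ.re)) : ℝ) : ℂ) * I) := by
  simp only [Complex.neg_re, Complex.neg_im, plateau_neg]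
  push_cast
  ring

/-- The unit vector of `-z` is minus that of `z`. [folklore] -/
theorem unit_neg (z : ℂ) : ((‖-z‖⁻¹ : ℝ) : ℂ) * (-z) = -(((‖z‖⁻¹ : ℝ) : ℂ) * z) := by
  rw [norm_neg, mul_neg]

/-- The unit vector of a positive real is `1`. [folklore] -/
theorem unit_of_pos {a : ℝ} (ha : 0 < a) : ((‖(a : ℂ)‖⁻¹ : ℝ) : ℂ) * (a : ℂ) = 1 := by
  rw [Complex.norm_real, Real.norm_of_nonneg ha.le, ← Complex.ofReal_mul, inv_mul_cancel₀ ha.ne',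
    Complex.ofReal_one]

/-- The unit vector of a negative real is `-1`. [folklore] -/
theorem unit_of_neg {a : ℝ} (ha : a < 0) : ((‖(a : ℂ)‖⁻¹ : ℝ) : ℂ) * (a : ℂ) = -1 := by
  rw [Complex.norm_real, Real.norm_eq_abs, abs_of_neg ha, ← Complex.ofReal_mul,
    show (-a)⁻¹ * a = -1 by rw [inv_neg, neg_mul, inv_mul_cancel₀ ha.ne]]
  simp

/-- The unit-vector map `z ↦ z/‖z‖` is real-smooth away from `0`. [folklore] -/
theorem contDiffAt_unit {z : ℂ} (hz : z ≠ 0) : ContDiffAt ℝ ∞ (fun w : ℂ => ((‖w‖⁻¹ : ℝ) : ℂ) * w) z :=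
  (Complex.ofRealCLM.contDiff.contDiffAt.comp z ((contDiffAt_norm ℝ hz).inv (norm_ne_zero_iff.2 hz))).mul
    contDiffAt_id

/-- The raw vector is a real-smooth function of `σ ∈ ℂ`. [folklore] -/
theorem contDiff_raw : ContDiff ℝ ∞ fun σ : ℂ => (σ.re : ℂ) +
    ((σ.im * (Real.smoothTransition (3 - 4 * σ.re) * Real.smoothTransition (3 + 4 * σ.re)) : ℝ) : ℂ) * I := by
  have hre : ContDiff ℝ ∞ fun σ : ℂ => σ.re := Complex.reCLM.contDiff
  have him : ContDiff ℝ ∞ fun σ : ℂ => σ.im := Complex.imCLM.contDiff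
  exact (Complex.ofRealCLM.contDiff.comp hre).add
    ((Complex.ofRealCLM.contDiff.comp (him.mul (contDiff_plateau.comp hre))).mul contDiff_const)

end Kappa

/-! ### §2 `κ` on the circle, the loop `θ`, the thin arcs `A`, and the braid map `G` -/

section Braid

variable {f : ModelProd (EuclideanSpace ℝ (Fin 1)) (EuclideanSpace ℝ (Fin 1)) ≃ₜ EuclideanSpace ℝ (Fin 2)}
  {x₀ : Circle × Circle} {r₀ δ : ℝ}
  {κ : Circle → ℂ} {θ : Circle → Circle × Circle} {A : EuclideanSpace ℝ (Fin 2) → Circle × Circle}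
  {G : Rechart f (Circle × Circle) × EuclideanSpace ℝ (Fin 2) → (Rechart f (Circle × Circle) × Circle) × Circle}

variable (hκ : ∀ σ : Circle, κ σ = ((‖((σ : ℂ).re : ℂ) + (((σ : ℂ).im *
      (Real.smoothTransition (3 - 4 * (σ : ℂ).re) * Real.smoothTransition (3 + 4 * (σ : ℂ).re)) : ℝ) : ℂ) * I‖⁻¹ : ℝ) : ℂ) *
    (((σ : ℂ).re : ℂ) + (((σ : ℂ).im *
      (Real.smoothTransition (3 - 4 * (σ : ℂ).re) * Real.smoothTransition (3 + 4 * (σ : ℂ).re)) : ℝ) : ℂ) * I))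
  (hθ : ∀ σ : Circle, θ σ = (x₀.1 * Circle.exp (r₀ * (κ σ).re), x₀.2 * Circle.exp (r₀ * (κ σ).im)))
  (hA : ∀ v : EuclideanSpace ℝ (Fin 2),
    A v = (Circle.exp (δ * Real.arctan (v 0) / 2), Circle.exp (δ * Real.arctan (v 1) / 2)))
  (hG : ∀ (w : Rechart f (Circle × Circle)) (v : EuclideanSpace ℝ (Fin 2)),
    G (w, v) = ((Rechart.into f (Circle × Circle) (θ (Rechart.out f (Circle × Circle) w).1 * A v),
      (Rechart.out f (Circle × Circle) w).1 ^ 2), (Rechart.out f (Circle × Circle) w).2))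

include hκ in
/-- `‖κ σ‖ = 1`. [folklore] -/
theorem norm_kappa (σ : Circle) : ‖κ σ‖ = 1 := by
  have hz := raw_ne_zero σ.norm_coe
  rw [hκ, norm_mul, Complex.norm_real, norm_inv, norm_norm,
    inv_mul_cancel₀ (norm_ne_zero_iff.2 hz)]

include hκ in
/-- `(Re κ)² + (Im κ)² = 1`. [folklore] -/
theorem kappa_re_sq_add_im_sq (σ : Circle) : (κ σ).re ^ 2 + (κ σ).im ^ 2 = 1 := by
  have h := norm_kappa hκ σ
  have : ‖κ σ‖ ^ 2 = (κ σ).re ^ 2 + (κ σ).im ^ 2 := by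
    rw [← Complex.normSq_eq_norm_sq, Complex.normSq_apply]; ring
  rw [← this, h]; norm_num

include hκ in
/-- **Flat spot at `σ = 1`**: `κ σ = 1` for `Re σ ≥ 3/4`. [folklore] -/
theorem kappa_eq_one {σ : Circle} (hσ : 3 / 4 ≤ (σ : ℂ).re) : κ σ = 1 := by
  rw [hκ, raw_eq_of_re_ge hσ]; exact unit_of_pos (by linarith)

include hκ in
/-- **Flat spot at `σ = -1`**: `κ σ = -1` for `Re σ ≤ -3/4`. [folklore] -/
theorem kappa_eq_neg_one {σ : Circle} (hσ : (σ : ℂ).re ≤ -(3 / 4)) : κ σ = -1 := by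
  rw [hκ, raw_eq_of_re_le hσ]; exact unit_of_neg (by linarith)

include hκ in
/-- **`κ` is odd**: `κ σ' = -κ σ` when `σ' = -σ`. [folklore] -/
theorem kappa_antipode {σ σ' : Circle} (h : (σ' : ℂ) = -(σ : ℂ)) : κ σ' = -κ σ := by
  rw [hκ, hκ, h, raw_neg, unit_neg]

include hκ in
/-- `κ` is smooth on the circle. [folklore] -/
theorem contMDiff_kappa : ContMDiff (𝓡 1) 𝓘(ℝ, ℂ) ∞ κ := by
  haveI : Fact (Module.finrank ℝ ℂ = 1 + 1) := finrank_real_complex_fact'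
  have hcoe : ContMDiff (𝓡 1) 𝓘(ℝ, ℂ) ∞ (fun z : Circle => (z : ℂ)) := contMDiff_coe_sphere
  have hfun : κ = (fun z : ℂ => ((‖(z.re : ℂ) + ((z.im * (Real.smoothTransition (3 - 4 * z.re) *
      Real.smoothTransition (3 + 4 * z.re)) : ℝ) : ℂ) * I‖⁻¹ : ℝ) : ℂ) * ((z.re : ℂ) +
      ((z.im * (Real.smoothTransition (3 - 4 * z.re) * Real.smoothTransition (3 + 4 * z.re)) : ℝ) : ℂ) * I)) ∘
      fun z : Circle => (z : ℂ) := funext fun σ => hκ σ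
  rw [hfun]
  intro σ
  have hF := (contDiffAt_unit (raw_ne_zero σ.norm_coe)).comp (σ : ℂ) contDiff_raw.contDiffAt
  exact hF.contMDiffAt.comp σ (hcoe σ)

include hκ hθ in
/-- The loop is smooth. [folklore] -/
theorem contMDiff_theta : ContMDiff (𝓡 1) ((𝓡 1).prod (𝓡 1)) ∞ θ := by
  have hk := contMDiff_kappa hκ
  have hre : ContMDiff (𝓡 1) 𝓘(ℝ, ℝ) ∞ fun σ => r₀ * (κ σ).re :=
    contMDiff_const.mul (Complex.reCLM.contMDiff.comp hk)
  have him : ContMDiff (𝓡 1) 𝓘(ℝ, ℝ) ∞ fun σ => r₀ * (κ σ).im :=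
    contMDiff_const.mul (Complex.imCLM.contMDiff.comp hk)
  have h1 : ContMDiff (𝓡 1) (𝓡 1) ∞ fun σ => x₀.1 * Circle.exp (r₀ * (κ σ).re) :=
    contMDiff_const.mul (contMDiff_circleExp.comp hre)
  have h2 : ContMDiff (𝓡 1) (𝓡 1) ∞ fun σ => x₀.2 * Circle.exp (r₀ * (κ σ).im) :=
    contMDiff_const.mul (contMDiff_circleExp.comp him)
  have : θ = fun σ => (x₀.1 * Circle.exp (r₀ * (κ σ).re), x₀.2 * Circle.exp (r₀ * (κ σ).im)) :=
    funext hθ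
  rw [this]
  exact h1.prodMk h2

include hκ hθ in
/-- **Flat spots of the loop**: `θ σ = x₂ := (x₀₁ e^{i r₀}, x₀₂)` for `Re σ ≥ 3/4` and
`θ σ = x₃ := (x₀₁ e^{-i r₀}, x₀₂)` for `Re σ ≤ -3/4`. [folklore] -/
theorem theta_flat :
    (∀ σ : Circle, 3 / 4 ≤ (σ : ℂ).re → θ σ = (x₀.1 * Circle.exp r₀, x₀.2)) ∧
    (∀ σ : Circle, (σ : ℂ).re ≤ -(3 / 4) → θ σ = (x₀.1 * Circle.exp (-r₀), x₀.2)) := by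
  constructor
  · intro σ hσ
    rw [hθ, kappa_eq_one hκ hσ]
    simp
  · intro σ hσ
    rw [hθ, kappa_eq_neg_one hκ hσ]
    simp

include hA in
/-- The thin arcs are smooth. [folklore] -/
theorem contMDiff_arcs : ContMDiff 𝓘(ℝ, EuclideanSpace ℝ (Fin 2)) ((𝓡 1).prod (𝓡 1)) ∞ A := by
  have hproj : ∀ i : Fin 2, ContMDiff 𝓘(ℝ, EuclideanSpace ℝ (Fin 2)) 𝓘(ℝ, ℝ) ∞
      (fun v : EuclideanSpace ℝ (Fin 2) => v i) :=
    fun i => (EuclideanSpace.proj (𝕜 := ℝ) (ι := Fin 2) i).contMDiff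
  have h : ∀ i : Fin 2, ContMDiff 𝓘(ℝ, EuclideanSpace ℝ (Fin 2)) (𝓡 1) ∞
      fun v : EuclideanSpace ℝ (Fin 2) => Circle.exp (δ * Real.arctan (v i) / 2) := fun i =>
    contMDiff_circleExp.comp
      ((contMDiff_const.mul (Real.contDiff_arctan.contMDiff.comp (hproj i))).div_const 2)
  have : A = fun v => (Circle.exp (δ * Real.arctan (v 0) / 2), Circle.exp (δ * Real.arctan (v 1) / 2)) :=
    funext hA
  rw [this]
  exact (h 0).prodMk (h 1)

include hκ hθ hA hG in
/-- **The braid map `G` is smooth.** [folklore] -/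
theorem contMDiff_braidMap (hf : ContMDiff ((𝓡 1).prod (𝓡 1)) 𝓘(ℝ, EuclideanSpace ℝ (Fin 2)) ∞ f)
    (hf' : ContMDiff 𝓘(ℝ, EuclideanSpace ℝ (Fin 2)) ((𝓡 1).prod (𝓡 1)) ∞ f.symm) :
    ContMDiff ((𝓡 2).prod (𝓡 2)) (((𝓡 2).prod (𝓡 1)).prod (𝓡 1)) ∞ G := by
  haveI hT : IsManifold (𝓡 2) ∞ (Rechart f (Circle × Circle)) := Rechart.isManifold f _ hf hf'
  have hout : ContMDiff (𝓡 2) ((𝓡 1).prod (𝓡 1)) ∞ (Rechart.out f (Circle × Circle)) :=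
    Rechart.contMDiff_out f _ hf hf'
  have hinto : ContMDiff ((𝓡 1).prod (𝓡 1)) (𝓡 2) ∞ (Rechart.into f (Circle × Circle)) :=
    Rechart.contMDiff_into f _ hf hf'
  have hσ : ContMDiff ((𝓡 2).prod (𝓡 2)) (𝓡 1) ∞
      fun p : Rechart f (Circle × Circle) × EuclideanSpace ℝ (Fin 2) =>
        (Rechart.out f (Circle × Circle) p.1).1 := contMDiff_fst.comp (hout.comp contMDiff_fst)
  have hτ : ContMDiff ((𝓡 2).prod (𝓡 2)) (𝓡 1) ∞
      fun p : Rechart f (Circle × Circle) × EuclideanSpace ℝ (Fin 2) =>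
        (Rechart.out f (Circle × Circle) p.1).2 := contMDiff_snd.comp (hout.comp contMDiff_fst)
  have hx : ContMDiff ((𝓡 2).prod (𝓡 2)) ((𝓡 1).prod (𝓡 1)) ∞
      fun p : Rechart f (Circle × Circle) × EuclideanSpace ℝ (Fin 2) =>
        θ (Rechart.out f (Circle × Circle) p.1).1 * A p.2 :=
    ((contMDiff_theta hκ hθ).comp hσ).mul ((contMDiff_arcs hA).comp contMDiff_snd)
  have : G = fun p : Rechart f (Circle × Circle) × EuclideanSpace ℝ (Fin 2) =>
      ((Rechart.into f (Circle × Circle) (θ (Rechart.out f (Circle × Circle) p.1).1 * A p.2),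
        (Rechart.out f (Circle × Circle) p.1).1 ^ 2), (Rechart.out f (Circle × Circle) p.1).2) :=
    funext fun ⟨w, v⟩ => hG w v
  rw [this]
  exact ((hinto.comp hx).prodMk (hσ.pow 2)).prodMk hτ

/-- **The squaring map of the circle is open** (it is conjugate to doubling on `ℝ` through the
local homeomorphism `exp`). [folklore] -/
theorem isOpenMap_circle_sq : IsOpenMap fun z : Circle => z ^ 2 := by
  intro U hU
  have hpre : IsOpen (Circle.exp ⁻¹' U) := hU.preimage Circle.exp.continuous
  have hdbl : IsOpen ((fun t : ℝ => 2 * t) '' (Circle.exp ⁻¹' U)) :=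
    (Homeomorph.mulLeft₀ (2 : ℝ) two_ne_zero).isOpenMap _ hpre
  have heq : (fun z : Circle => z ^ 2) '' U = Circle.exp '' ((fun t : ℝ => 2 * t) '' (Circle.exp ⁻¹' U)) := by
    ext z
    constructor
    · rintro ⟨y, hy, rfl⟩
      obtain ⟨t, rfl⟩ := Circle.exp_surjective y
      refine ⟨2 * t, ⟨t, hy, rfl⟩, ?_⟩
      show Circle.exp (2 * t) = Circle.exp t ^ 2
      rw [two_mul, Circle.exp_add, sq]
    · rintro ⟨_, ⟨t, ht, rfl⟩, rfl⟩
      refine ⟨Circle.exp t, ht, ?_⟩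
      show Circle.exp t ^ 2 = Circle.exp (2 * t)
      rw [two_mul, Circle.exp_add, sq]
  rw [heq]
  exact isLocalHomeomorph_circleExp.isOpenMap _ hdbl

/-- `t ↦ exp(i δ arctan(t)/2)` is an open map into the circle for `δ ≠ 0`. [folklore] -/
theorem isOpenMap_circleExp_mul_arctan {δ : ℝ} (hδ : δ ≠ 0) :
    IsOpenMap fun t : ℝ => Circle.exp (δ * Real.arctan t / 2) := by
  have h1 : IsOpenMap Real.arctan := by
    have : Real.arctan = (Subtype.val : Ioo (-(π / 2)) (π / 2) → ℝ) ∘ Real.tanOrderIso.symm := by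
      funext t; rfl
    rw [this]
    exact isOpen_Ioo.isOpenMap_subtype_val.comp Real.tanOrderIso.symm.toHomeomorph.isOpenMap
  have h2 : IsOpenMap fun a : ℝ => δ * a / 2 := by
    have : (fun a : ℝ => δ * a / 2) = Homeomorph.mulLeft₀ (δ / 2) (by positivity) := by
      funext a; simp [Homeomorph.mulLeft₀]; ring
    rw [this]; exact (Homeomorph.mulLeft₀ (δ / 2) _).isOpenMap
  have : (fun t : ℝ => Circle.exp (δ * Real.arctan t / 2)) = Circle.exp ∘ (fun a => δ * a / 2) ∘ Real.arctan := by
    funext t; rfl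
  rw [this]
  exact isLocalHomeomorph_circleExp.isOpenMap.comp (h2.comp h1)

include hκ hθ hA hG in
/-- **The braid map `G` is open**: it is the composite of the open map `(w, v) ↦ (out w, A v)`,
the homeomorphism `((σ, τ), p) ↦ ((σ, τ), θ σ · p)` and the open map
`((σ, τ), p) ↦ ((into p, σ²), τ)` (the squaring of the circle is open). [folklore] -/
theorem isOpenMap_braidMap (hδ : δ ≠ 0) : IsOpenMap G := by
  let out := Rechart.out f (Circle × Circle)
  let into := Rechart.into f (Circle × Circle)
  have hθc : Continuous θ := (contMDiff_theta hκ hθ).continuous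
  -- the three factors
  let K : Rechart f (Circle × Circle) × EuclideanSpace ℝ (Fin 2) → (Circle × Circle) × (Circle × Circle) :=
    fun p => (out p.1, A p.2)
  let H₁ : (Circle × Circle) × (Circle × Circle) ≃ₜ (Circle × Circle) × (Circle × Circle) :=
    { toFun := fun q => (q.1, θ q.1.1 * q.2)
      invFun := fun q => (q.1, (θ q.1.1)⁻¹ * q.2)
      left_inv := fun q => by simp
      right_inv := fun q => by simp
      continuous_toFun := continuous_fst.prodMk
        ((hθc.comp (continuous_fst.comp continuous_fst)).mul continuous_snd)
      continuous_invFun := continuous_fst.prodMk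
        ((hθc.comp (continuous_fst.comp continuous_fst)).inv.mul continuous_snd) }
  let R : (Circle × Circle) × (Circle × Circle) ≃ₜ ((Circle × Circle) × Circle) × Circle :=
    { toFun := fun q => ((q.2, q.1.1), q.1.2)
      invFun := fun q => ((q.1.2, q.2), q.1.1)
      left_inv := fun q => rfl
      right_inv := fun q => rfl
      continuous_toFun := by fun_prop
      continuous_invFun := by fun_prop }
  let H₂ : (Circle × Circle) × (Circle × Circle) → (Rechart f (Circle × Circle) × Circle) × Circle :=
    fun q => ((into q.2, q.1.1 ^ 2), q.1.2)
  have hK : IsOpenMap K := by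
    let πE : EuclideanSpace ℝ (Fin 2) ≃ₜ ℝ × ℝ :=
      (EuclideanSpace.equiv (Fin 2) ℝ).toHomeomorph.trans (Homeomorph.piFinTwo fun _ => ℝ)
    have hA' : IsOpenMap A := by
      have : A = Prod.map (fun t : ℝ => Circle.exp (δ * Real.arctan t / 2))
          (fun t : ℝ => Circle.exp (δ * Real.arctan t / 2)) ∘ πE := by
        funext v; rw [hA]; rfl
      rw [this]
      exact ((isOpenMap_circleExp_mul_arctan hδ).prodMap (isOpenMap_circleExp_mul_arctan hδ)).comp
        πE.isOpenMap
    have : K = Prod.map out A := rfl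
    rw [this]
    exact (Rechart.outHomeomorph f (Circle × Circle)).isOpenMap.prodMap hA'
  have hH₂ : IsOpenMap H₂ := by
    have : H₂ = Prod.map (Prod.map into (fun z : Circle => z ^ 2)) id ∘ R := by
      funext q; rfl
    rw [this]
    exact (((Rechart.outHomeomorph f (Circle × Circle)).symm.isOpenMap.prodMap
      isOpenMap_circle_sq).prodMap IsOpenMap.id).comp R.isOpenMap
  have hGeq : G = H₂ ∘ H₁ ∘ K := by
    funext p
    obtain ⟨w, v⟩ := p
    rw [hG]
    rfl
  rw [hGeq]
  exact hH₂.comp (H₁.isOpenMap.comp hK)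

/-- Small real numbers with the same point on the circle are equal (`|x|, |y| < π`). [folklore] -/
theorem circleExp_inj_of_abs_lt {x y : ℝ} (hx : |x| < π) (hy : |y| < π) (h : Circle.exp x = Circle.exp y) :
    x = y := by
  have h' := congrArg (fun z : Circle => Complex.arg (z : ℂ)) h
  rwa [Circle.arg_exp (abs_lt.1 hx).1 (abs_lt.1 hx).2.le,
    Circle.arg_exp (abs_lt.1 hy).1 (abs_lt.1 hy).2.le] at h'

/-- `|δ arctan t / 2| ≤ δ π/4` for `δ ≥ 0`. [folklore] -/
theorem abs_mul_arctan_div_two_le {δ : ℝ} (hδ : 0 ≤ δ) (t : ℝ) : |δ * Real.arctan t / 2| ≤ δ * (π / 4) := by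
  have h1 := Real.arctan_lt_pi_div_two t
  have h2 := Real.neg_pi_div_two_lt_arctan t
  have : |Real.arctan t| ≤ π / 2 := abs_le.2 ⟨by linarith, by linarith⟩
  rw [abs_div, abs_mul, abs_of_nonneg hδ, abs_two]
  nlinarith

include hκ hθ hA hG in
/-- **The braid map is injective** (`0 < r₀ ≤ 1/8`, `0 < δ ≤ r₀/5`).  Equal images have equal
`τ` and equal `σ²`, so `σ' = ±σ`; if `σ' = σ` the thin arcs give `v = v'`; if `σ' = -σ` then
`κ σ' = -κ σ` and comparing the first-torus coordinates gives `|2 r₀ Re κ|, |2 r₀ Im κ| ≤ δ π/2`,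
impossible since `(Re κ)² + (Im κ)² = 1` and `δ π < 2√2 r₀`. [cite: AkhmedovPark2010, §3] -/
theorem injective_braidMap (hr₀ : 0 < r₀) (hr₀' : r₀ ≤ 1 / 8) (hδ : 0 < δ) (hδ' : δ ≤ r₀ / 5) :
    Injective G := by
  rintro ⟨w, v⟩ ⟨w', v'⟩ h
  rw [hG, hG] at h
  simp only [Prod.mk.injEq] at h
  obtain ⟨⟨hx, hsq⟩, hτ⟩ := h
  set σ := (Rechart.out f (Circle × Circle) w).1 with hσdef
  set σ' := (Rechart.out f (Circle × Circle) w').1 with hσ'def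
  -- `into` is injective, so the first-torus points agree
  have hx' : θ σ * A v = θ σ' * A v' := by
    have := congrArg (Rechart.out f (Circle × Circle)) hx
    rwa [Rechart.out_into, Rechart.out_into] at this
  have h1 := congrArg Prod.fst hx'
  have h2 := congrArg Prod.snd hx'
  rw [hθ, hθ, hA, hA] at h1 h2
  simp only [Prod.fst_mul, Prod.snd_mul] at h1 h2
  have e1 : Circle.exp (r₀ * (κ σ).re + δ * Real.arctan (v 0) / 2) =
      Circle.exp (r₀ * (κ σ').re + δ * Real.arctan (v' 0) / 2) := by
    rw [Circle.exp_add, Circle.exp_add]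
    rw [mul_assoc, mul_assoc] at h1
    exact mul_left_cancel h1
  have e2 : Circle.exp (r₀ * (κ σ).im + δ * Real.arctan (v 1) / 2) =
      Circle.exp (r₀ * (κ σ').im + δ * Real.arctan (v' 1) / 2) := by
    rw [Circle.exp_add, Circle.exp_add]
    rw [mul_assoc, mul_assoc] at h2
    exact mul_left_cancel h2
  -- bounds on the angles
  have hπ := Real.pi_pos
  have hπ3 := Real.pi_gt_three
  have hπ4 := Real.pi_lt_four
  have hbd : ∀ ρ : Circle, |(κ ρ).re| ≤ 1 ∧ |(κ ρ).im| ≤ 1 := fun ρ => by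
    have h := kappa_re_sq_add_im_sq hκ ρ
    constructor <;> refine abs_le.2 ⟨?_, ?_⟩ <;> nlinarith [sq_nonneg ((κ ρ).re), sq_nonneg ((κ ρ).im)]
  have hs : ∀ t : ℝ, |δ * Real.arctan t / 2| ≤ δ * (π / 4) := abs_mul_arctan_div_two_le hδ.le
  have hsmall : ∀ (ρ : Circle) (t : ℝ), |r₀ * (κ ρ).re + δ * Real.arctan t / 2| < π ∧
      |r₀ * (κ ρ).im + δ * Real.arctan t / 2| < π := fun ρ t => by
    obtain ⟨ha, hb⟩ := hbd ρ
    have h₁ : |r₀ * (κ ρ).re| ≤ r₀ := by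
      rw [abs_mul, abs_of_pos hr₀]; exact mul_le_of_le_one_right hr₀.le ha
    have h₂ : |r₀ * (κ ρ).im| ≤ r₀ := by
      rw [abs_mul, abs_of_pos hr₀]; exact mul_le_of_le_one_right hr₀.le hb
    have h₃ := hs t
    have hδπ : δ * (π / 4) ≤ 1 := by nlinarith
    constructor
    · calc |r₀ * (κ ρ).re + δ * Real.arctan t / 2| ≤ |r₀ * (κ ρ).re| + |δ * Real.arctan t / 2| :=
          abs_add_le _ _
        _ < π := by linarith
    · calc |r₀ * (κ ρ).im + δ * Real.arctan t / 2| ≤ |r₀ * (κ ρ).im| + |δ * Real.arctan t / 2| :=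
          abs_add_le _ _
        _ < π := by linarith
  have E1 := circleExp_inj_of_abs_lt (hsmall σ (v 0)).1 (hsmall σ' (v' 0)).1 e1
  have E2 := circleExp_inj_of_abs_lt (hsmall σ (v 1)).2 (hsmall σ' (v' 1)).2 e2
  -- `σ² = σ'²` in the circle: `σ' = σ` or `σ' = -σ`
  have hsqC : ((σ' : Circle) : ℂ) ^ 2 = ((σ : Circle) : ℂ) ^ 2 := by
    have := congrArg (fun z : Circle => (z : ℂ)) hsq
    simp only [Circle.coe_pow] at this
    exact this.symm
  rcases sq_eq_sq_iff_eq_or_eq_neg.1 hsqC with heq | hneg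
  · -- same string: `σ' = σ`, then `v = v'` from the arcs and `w = w'`
    have hσσ : σ' = σ := Subtype.ext heq
    rw [hσσ] at E1 E2
    have hv0 : v 0 = v' 0 := by
      have : Real.arctan (v 0) = Real.arctan (v' 0) := by
        have h : δ * (Real.arctan (v 0) - Real.arctan (v' 0)) = 0 := by linarith
        rcases mul_eq_zero.1 h with h | h
        · exact absurd h hδ.ne'
        · linarith
      exact Real.arctan_injective this
    have hv1 : v 1 = v' 1 := by
      have : Real.arctan (v 1) = Real.arctan (v' 1) := by
        have h : δ * (Real.arctan (v 1) - Real.arctan (v' 1)) = 0 := by linarith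
        rcases mul_eq_zero.1 h with h | h
        · exact absurd h hδ.ne'
        · linarith
      exact Real.arctan_injective this
    have hvv : v = v' := by
      ext i; fin_cases i
      · exact hv0
      · exact hv1
    have hww : w = w' := by
      have hout : Rechart.out f (Circle × Circle) w = Rechart.out f (Circle × Circle) w' :=
        Prod.ext (by rw [← hσdef, ← hσ'def, hσσ]) hτ
      rw [← Rechart.into_out f _ w, hout, Rechart.into_out]
    rw [hvv, hww]
  · -- antipodal strings: contradiction
    exfalso
    have hk : κ σ' = -κ σ := kappa_antipode hκ hneg
    rw [hk, Complex.neg_re] at E1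
    rw [hk, Complex.neg_im] at E2
    have hs0 := hs (v 0); have hs0' := hs (v' 0); have hs1 := hs (v 1); have hs1' := hs (v' 1)
    have hab := kappa_re_sq_add_im_sq hκ σ
    -- `|2 r₀ a| ≤ δ π / 2`, `|2 r₀ b| ≤ δ π / 2`
    have hA1 : |2 * r₀ * (κ σ).re| ≤ δ * (π / 2) := by
      have : 2 * r₀ * (κ σ).re = δ * Real.arctan (v' 0) / 2 - δ * Real.arctan (v 0) / 2 := by linarith
      rw [this]
      calc |δ * Real.arctan (v' 0) / 2 - δ * Real.arctan (v 0) / 2|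
          ≤ |δ * Real.arctan (v' 0) / 2| + |δ * Real.arctan (v 0) / 2| := abs_sub _ _
        _ ≤ δ * (π / 2) := by linarith
    have hA2 : |2 * r₀ * (κ σ).im| ≤ δ * (π / 2) := by
      have : 2 * r₀ * (κ σ).im = δ * Real.arctan (v' 1) / 2 - δ * Real.arctan (v 1) / 2 := by linarith
      rw [this]
      calc |δ * Real.arctan (v' 1) / 2 - δ * Real.arctan (v 1) / 2|
          ≤ |δ * Real.arctan (v' 1) / 2| + |δ * Real.arctan (v 1) / 2| := abs_sub _ _
        _ ≤ δ * (π / 2) := by linarith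
    have hδπ : 0 ≤ δ * (π / 2) := by positivity
    have hq1 : (2 * r₀ * (κ σ).re) ^ 2 ≤ (δ * (π / 2)) ^ 2 := by
      rw [← sq_abs (2 * r₀ * (κ σ).re)]
      exact pow_le_pow_left₀ (abs_nonneg _) hA1 2
    have hq2 : (2 * r₀ * (κ σ).im) ^ 2 ≤ (δ * (π / 2)) ^ 2 := by
      rw [← sq_abs (2 * r₀ * (κ σ).im)]
      exact pow_le_pow_left₀ (abs_nonneg _) hA2 2
    -- `4 r₀² = (2r₀a)² + (2r₀b)² ≤ δ²π²/2 ≤ r₀² π² / 50 < r₀²`, absurd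
    have h4 : 4 * r₀ ^ 2 ≤ 2 * (δ * (π / 2)) ^ 2 := by nlinarith
    have h5 : δ * (π / 2) ≤ r₀ / 5 * (π / 2) := by nlinarith
    have h6 : (δ * (π / 2)) ^ 2 ≤ (r₀ / 5 * (π / 2)) ^ 2 := pow_le_pow_left₀ hδπ h5 2
    have h7 : (r₀ / 5 * (π / 2)) ^ 2 = r₀ ^ 2 * π ^ 2 / 100 := by ring
    rw [h7] at h6
    have hπ2 : π ^ 2 < 16 := by nlinarith
    have h8 : r₀ ^ 2 * π ^ 2 < r₀ ^ 2 * 16 := mul_lt_mul_of_pos_left hπ2 (pow_pos hr₀ 2)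
    nlinarith [pow_pos hr₀ 2]

end Braid

/-! ### §3 The tube `T₂ = e⁻¹ ∘ G` is a smooth embedding with open range -/

section LocalInverse

/-- **Local square root on the circle.**  If `ζ = σ' σ₀⁻¹` satisfies `Re ζ > 0`, `Re ζ² > 0`, then
`σ₀ · exp(i arctan(Im(σ'² σ₀⁻²)/Re(σ'² σ₀⁻²))/2) = σ'`. [folklore] -/
theorem circle_sqrtNear_sq {σ₀ σ' : Circle} (h1 : 0 < ((σ' * σ₀⁻¹ : Circle) : ℂ).re)
    (h2 : 0 < (((σ' * σ₀⁻¹ : Circle) : ℂ) ^ 2).re) :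
    σ₀ * Circle.exp (Real.arctan ((((σ' ^ 2 * (σ₀ ^ 2)⁻¹ : Circle)) : ℂ).im /
      (((σ' ^ 2 * (σ₀ ^ 2)⁻¹ : Circle)) : ℂ).re) / 2) = σ' := by
  have hζ : σ' ^ 2 * (σ₀ ^ 2)⁻¹ = (σ' * σ₀⁻¹) ^ 2 := by rw [mul_pow, inv_pow]
  have hcoe : (((σ' ^ 2 * (σ₀ ^ 2)⁻¹ : Circle)) : ℂ) = ((σ' * σ₀⁻¹ : Circle) : ℂ) ^ 2 := by
    rw [hζ, Circle.coe_pow]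
  rw [hcoe, circleExp_arctan_half_eq h1 h2, mul_comm σ' σ₀⁻¹, mul_inv_cancel_left]

/-- The local square root is smooth where `Re(y σ₀⁻²) ≠ 0`. [folklore] -/
theorem contMDiffOn_circle_sqrtNear (σ₀ : Circle) :
    ContMDiffOn (𝓡 1) (𝓡 1) ∞ (fun y : Circle => σ₀ * Circle.exp (Real.arctan
        ((((y * (σ₀ ^ 2)⁻¹ : Circle)) : ℂ).im / (((y * (σ₀ ^ 2)⁻¹ : Circle)) : ℂ).re) / 2))
      {y : Circle | (((y * (σ₀ ^ 2)⁻¹ : Circle)) : ℂ).re ≠ 0} := by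
  haveI : Fact (Module.finrank ℝ ℂ = 1 + 1) := finrank_real_complex_fact'
  have hcoe : ContMDiff (𝓡 1) 𝓘(ℝ, ℂ) ∞ (fun z : Circle => (z : ℂ)) := contMDiff_coe_sphere
  have h1 : ContMDiff (𝓡 1) 𝓘(ℝ, ℂ) ∞ (fun y : Circle => ((y * (σ₀ ^ 2)⁻¹ : Circle) : ℂ)) :=
    hcoe.comp contMDiff_mul_right
  have hdiv : ContDiffOn ℝ ∞ (fun w : ℂ => Real.arctan (w.im / w.re) / 2) {w : ℂ | w.re ≠ 0} :=
    (Real.contDiff_arctan.comp_contDiffOn (Complex.imCLM.contDiff.contDiffOn.div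
      Complex.reCLM.contDiff.contDiffOn fun w hw => hw)).div_const 2
  have h2 : ContMDiffOn (𝓡 1) 𝓘(ℝ, ℝ) ∞ (fun y : Circle => Real.arctan
      ((((y * (σ₀ ^ 2)⁻¹ : Circle)) : ℂ).im / (((y * (σ₀ ^ 2)⁻¹ : Circle)) : ℂ).re) / 2)
      {y : Circle | (((y * (σ₀ ^ 2)⁻¹ : Circle)) : ℂ).re ≠ 0} :=
    hdiv.contMDiffOn.comp h1.contMDiffOn fun y hy => hy
  exact contMDiffOn_const.mul (contMDiff_circleExp.comp_contMDiffOn h2)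

/-- **Thin arc coordinate.**  `tan((2/δ) arctan(Im a/Re a))` recovers `t` from
`a = exp(i δ arctan(t)/2)` (`0 < δ ≤ 1`). [folklore] -/
theorem tan_arctan_im_div_re_circleExp {δ : ℝ} (hδ : 0 < δ) (hδ1 : δ ≤ 1) (t : ℝ) :
    Real.tan (2 / δ * Real.arctan (((Circle.exp (δ * Real.arctan t / 2) : Circle) : ℂ).im /
      ((Circle.exp (δ * Real.arctan t / 2) : Circle) : ℂ).re)) = t := by
  have ha1 := Real.arctan_lt_pi_div_two t
  have ha2 := Real.neg_pi_div_two_lt_arctan t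
  have hπ := Real.pi_pos
  have hb1 : -(π / 2) < δ * Real.arctan t / 2 := by nlinarith
  have hb2 : δ * Real.arctan t / 2 < π / 2 := by nlinarith
  rw [Circle.coe_exp, Complex.exp_ofReal_mul_I_re, Complex.exp_ofReal_mul_I_im,
    ← Real.tan_eq_sin_div_cos, Real.arctan_tan hb1 hb2]
  have : 2 / δ * (δ * Real.arctan t / 2) = Real.arctan t := by field_simp
  rw [this, Real.tan_arctan]

/-- The thin arc coordinate is smooth at the points of the arc. [folklore] -/
theorem contMDiffAt_thinArcCoord {δ : ℝ} (hδ : 0 < δ) (hδ1 : δ ≤ 1) (t : ℝ) :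
    ContMDiffAt (𝓡 1) 𝓘(ℝ, ℝ) ∞
      (fun a : Circle => Real.tan (2 / δ * Real.arctan ((a : ℂ).im / (a : ℂ).re)))
      (Circle.exp (δ * Real.arctan t / 2)) := by
  haveI : Fact (Module.finrank ℝ ℂ = 1 + 1) := finrank_real_complex_fact'
  have hcoe : ContMDiff (𝓡 1) 𝓘(ℝ, ℂ) ∞ (fun z : Circle => (z : ℂ)) := contMDiff_coe_sphere
  have ha1 := Real.arctan_lt_pi_div_two t
  have ha2 := Real.neg_pi_div_two_lt_arctan t
  have hπ := Real.pi_pos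
  have hb1 : -(π / 2) < δ * Real.arctan t / 2 := by nlinarith
  have hb2 : δ * Real.arctan t / 2 < π / 2 := by nlinarith
  have hre : 0 < (((Circle.exp (δ * Real.arctan t / 2) : Circle) : ℂ)).re := by
    rw [Circle.coe_exp, Complex.exp_ofReal_mul_I_re]
    exact Real.cos_pos_of_mem_Ioo ⟨hb1, hb2⟩
  have hdiv : ContDiffOn ℝ ∞ (fun w : ℂ => w.im / w.re) {w : ℂ | w.re ≠ 0} :=
    Complex.imCLM.contDiff.contDiffOn.div Complex.reCLM.contDiff.contDiffOn fun w hw => hw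
  have hg1 : ContDiffAt ℝ ∞ (fun w : ℂ => w.im / w.re)
      (((Circle.exp (δ * Real.arctan t / 2) : Circle) : ℂ)) :=
    hdiv.contDiffAt ((isOpen_ne_fun Complex.continuous_re continuous_const).mem_nhds hre.ne')
  have hg2 : ContDiffAt ℝ ∞ (fun w : ℂ => 2 / δ * Real.arctan (w.im / w.re))
      (((Circle.exp (δ * Real.arctan t / 2) : Circle) : ℂ)) :=
    contDiffAt_const.mul (Real.contDiff_arctan.contDiffAt.comp _ hg1)
  have hval : 2 / δ * Real.arctan ((((Circle.exp (δ * Real.arctan t / 2) : Circle) : ℂ)).im /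
      (((Circle.exp (δ * Real.arctan t / 2) : Circle) : ℂ)).re) = Real.arctan t := by
    rw [Circle.coe_exp, Complex.exp_ofReal_mul_I_re, Complex.exp_ofReal_mul_I_im,
      ← Real.tan_eq_sin_div_cos, Real.arctan_tan hb1 hb2]
    field_simp
  have htan : ContDiffAt ℝ ∞ Real.tan (2 / δ * Real.arctan
      ((((Circle.exp (δ * Real.arctan t / 2) : Circle) : ℂ)).im /
        (((Circle.exp (δ * Real.arctan t / 2) : Circle) : ℂ)).re)) := by
    rw [hval]
    exact Real.contDiffAt_tan.2 (Real.cos_arctan_pos t).ne'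
  have hg : ContDiffAt ℝ ∞ (Real.tan ∘ fun w : ℂ => 2 / δ * Real.arctan (w.im / w.re))
      (((Circle.exp (δ * Real.arctan t / 2) : Circle) : ℂ)) :=
    ContDiffAt.comp (g := Real.tan) (f := fun w : ℂ => 2 / δ * Real.arctan (w.im / w.re))
      _ htan hg2
  have := ContMDiffAt.comp (Circle.exp (δ * Real.arctan t / 2)) hg.contMDiffAt hcoe.contMDiffAt
  exact this

/-- For a unit complex number, `Re σ² > 1/8` forces `|Re σ| > 3/4` (the flat spots of `κ` seen
from the braid axis). [folklore] -/
theorem abs_re_gt_of_re_sq_gt {σ : Circle} (h : 1 / 8 < (((σ : ℂ)) ^ 2).re) :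
    3 / 4 < |(σ : ℂ).re| := by
  have hn : (σ : ℂ).re ^ 2 + (σ : ℂ).im ^ 2 = 1 := by
    have h1 : ‖(σ : ℂ)‖ ^ 2 = 1 := by rw [Circle.norm_coe, one_pow]
    rw [Complex.sq_norm, Complex.normSq_apply] at h1
    nlinarith [h1]
  have hsq : (((σ : ℂ)) ^ 2).re = (σ : ℂ).re ^ 2 - (σ : ℂ).im ^ 2 := by
    rw [sq, Complex.mul_re]; ring
  rw [hsq] at h
  by_contra hc
  rw [not_lt] at hc
  have := abs_le.1 hc
  nlinarith [sq_abs ((σ : ℂ).re), abs_nonneg ((σ : ℂ).re)]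

end LocalInverse

section Tube

variable {f : ModelProd (EuclideanSpace ℝ (Fin 1)) (EuclideanSpace ℝ (Fin 1)) ≃ₜ EuclideanSpace ℝ (Fin 2)}
  {x₀ : Circle × Circle} {r₀ δ : ℝ}
  {κ : Circle → ℂ} {θ : Circle → Circle × Circle} {A : EuclideanSpace ℝ (Fin 2) → Circle × Circle}
  {G : Rechart f (Circle × Circle) × EuclideanSpace ℝ (Fin 2) → (Rechart f (Circle × Circle) × Circle) × Circle}

variable (hκ : ∀ σ : Circle, κ σ = ((‖((σ : ℂ).re : ℂ) + (((σ : ℂ).im *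
      (Real.smoothTransition (3 - 4 * (σ : ℂ).re) * Real.smoothTransition (3 + 4 * (σ : ℂ).re)) : ℝ) : ℂ) * I‖⁻¹ : ℝ) : ℂ) *
    (((σ : ℂ).re : ℂ) + (((σ : ℂ).im *
      (Real.smoothTransition (3 - 4 * (σ : ℂ).re) * Real.smoothTransition (3 + 4 * (σ : ℂ).re)) : ℝ) : ℂ) * I))
  (hθ : ∀ σ : Circle, θ σ = (x₀.1 * Circle.exp (r₀ * (κ σ).re), x₀.2 * Circle.exp (r₀ * (κ σ).im)))
  (hA : ∀ v : EuclideanSpace ℝ (Fin 2),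
    A v = (Circle.exp (δ * Real.arctan (v 0) / 2), Circle.exp (δ * Real.arctan (v 1) / 2)))
  (hG : ∀ (w : Rechart f (Circle × Circle)) (v : EuclideanSpace ℝ (Fin 2)),
    G (w, v) = ((Rechart.into f (Circle × Circle) (θ (Rechart.out f (Circle × Circle) w).1 * A v),
      (Rechart.out f (Circle × Circle) w).1 ^ 2), (Rechart.out f (Circle × Circle) w).2))

include hκ hθ hG in
/-- **Flat spots of the braided torus**: over `Re σ ≥ 3/4` the tube is the product tube
`((into (x₂ · A v), σ²), τ)`, `x₂ = (x₀₁ e^{i r₀}, x₀₂)`, and over `Re σ ≤ -3/4` likewise with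
`x₃ = (x₀₁ e^{-i r₀}, x₀₂)`. [cite: AkhmedovPark2010, §3] -/
theorem braidMap_flat :
    (∀ (w : Rechart f (Circle × Circle)) (v : EuclideanSpace ℝ (Fin 2)),
      3 / 4 ≤ (((Rechart.out f (Circle × Circle) w).1 : Circle) : ℂ).re →
      G (w, v) = ((Rechart.into f (Circle × Circle) ((x₀.1 * Circle.exp r₀, x₀.2) * A v),
        (Rechart.out f (Circle × Circle) w).1 ^ 2), (Rechart.out f (Circle × Circle) w).2)) ∧
    (∀ (w : Rechart f (Circle × Circle)) (v : EuclideanSpace ℝ (Fin 2)),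
      (((Rechart.out f (Circle × Circle) w).1 : Circle) : ℂ).re ≤ -(3 / 4) →
      G (w, v) = ((Rechart.into f (Circle × Circle) ((x₀.1 * Circle.exp (-r₀), x₀.2) * A v),
        (Rechart.out f (Circle × Circle) w).1 ^ 2), (Rechart.out f (Circle × Circle) w).2)) := by
  obtain ⟨hp, hn⟩ := theta_flat hκ hθ
  exact ⟨fun w v h => by rw [hG, hp _ h], fun w v h => by rw [hG, hn _ h]⟩

include hκ hθ hA hG in
/-- **The tube of the braided torus is a smooth embedding with open range.**  For a smooth
`4`-manifold `X` with `e : X ≃ (T × S¹) × S¹` smooth both ways (`T = Rechart f (S¹ × S¹)`),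
`0 < r₀ ≤ 1/8` and `0 < δ ≤ r₀/5`, the map `T₂ = e⁻¹ ∘ G : T × ℝ² → X`,
`G (w, v) = ((into (θ σ · A v), σ²), τ)`, is a smooth embedding for `(𝓡 2).prod (𝓡 2) → 𝓡 4` with
open range: `G` is smooth, injective (`injective_braidMap`) and open (`isOpenMap_braidMap`), and
its inverse is smooth on the range, being given near `G (w₀, v₀)` by the local square root
`σ = σ₀ exp(i arctan(Im(y₁σ₀⁻²)/Re(y₁σ₀⁻²))/2)` of `y₁ = σ²` and the thin arc coordinates of
`out (y.1.1) · (θ σ)⁻¹` (Lee 2013, Prop. 5.2).  This is the tubular neighbourhood of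
`T_β ⊂ T⁴` of Akhmedov–Park. [cite: AkhmedovPark2010, §3] [cite: LeeSmoothManifolds2013, Prop. 5.2] -/
theorem isSmoothEmbedding_braidedTorusTube
    {X : Type*} [TopologicalSpace X] [ChartedSpace (EuclideanSpace ℝ (Fin 4)) X]
    [IsManifold (𝓡 4) ∞ X]
    (hf : ContMDiff ((𝓡 1).prod (𝓡 1)) 𝓘(ℝ, EuclideanSpace ℝ (Fin 2)) ∞ f)
    (hf' : ContMDiff 𝓘(ℝ, EuclideanSpace ℝ (Fin 2)) ((𝓡 1).prod (𝓡 1)) ∞ f.symm)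
    (e : X ≃ₜ (Rechart f (Circle × Circle) × Circle) × Circle)
    (he : ContMDiff (𝓡 4) (((𝓡 2).prod (𝓡 1)).prod (𝓡 1)) ∞ e)
    (he' : ContMDiff (((𝓡 2).prod (𝓡 1)).prod (𝓡 1)) (𝓡 4) ∞ e.symm)
    (hr₀ : 0 < r₀) (hr₀' : r₀ ≤ 1 / 8) (hδ : 0 < δ) (hδ' : δ ≤ r₀ / 5) :
    Manifold.IsSmoothEmbedding ((𝓡 2).prod (𝓡 2)) (𝓡 4) ∞
        (fun q : Rechart f (Circle × Circle) × EuclideanSpace ℝ (Fin 2) => e.symm (G q)) ∧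
      IsOpen (range fun q : Rechart f (Circle × Circle) × EuclideanSpace ℝ (Fin 2) =>
        e.symm (G q)) := by
  haveI hT : IsManifold (𝓡 2) ∞ (Rechart f (Circle × Circle)) := Rechart.isManifold f _ hf hf'
  haveI : Fact (Module.finrank ℝ ℂ = 1 + 1) := finrank_real_complex_fact'
  have hδ1 : δ ≤ 1 := by linarith
  -- notation
  have hout : ContMDiff (𝓡 2) ((𝓡 1).prod (𝓡 1)) ∞ (Rechart.out f (Circle × Circle)) :=
    Rechart.contMDiff_out f _ hf hf'
  have hinto : ContMDiff ((𝓡 1).prod (𝓡 1)) (𝓡 2) ∞ (Rechart.into f (Circle × Circle)) :=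
    Rechart.contMDiff_into f _ hf hf'
  let TT : Rechart f (Circle × Circle) × EuclideanSpace ℝ (Fin 2) → X := fun q => e.symm (G q)
  have hTTsm : ContMDiff ((𝓡 2).prod (𝓡 2)) (𝓡 4) ∞ TT :=
    he'.comp (contMDiff_braidMap hκ hθ hA hG hf hf')
  have hGinj : Injective G := injective_braidMap hκ hθ hA hG hr₀ hr₀' hδ hδ'
  have hinj : Injective TT := e.symm.injective.comp hGinj
  have hopen : IsOpenMap TT := e.symm.isOpenMap.comp (isOpenMap_braidMap hκ hθ hA hG hδ.ne')
  -- the inverse on the range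
  haveI : Nonempty (Rechart f (Circle × Circle) × EuclideanSpace ℝ (Fin 2)) :=
    ⟨(Rechart.into f (Circle × Circle) (1, 1), 0)⟩
  let finv : X → Rechart f (Circle × Circle) × EuclideanSpace ℝ (Fin 2) := Function.invFun TT
  have hleft : ∀ q, finv (TT q) = q := Function.leftInverse_invFun hinj
  -- the coordinate vector of `ℝ²`
  let u₀ : EuclideanSpace ℝ (Fin 2) := EuclideanSpace.single 0 1
  let u₁ : EuclideanSpace ℝ (Fin 2) := EuclideanSpace.single 1 1
  let toE : ℝ → ℝ → EuclideanSpace ℝ (Fin 2) := fun a b => a • u₀ + b • u₁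
  have htoE : ∀ v : EuclideanSpace ℝ (Fin 2), toE (v 0) (v 1) = v := fun v => by
    ext i
    fin_cases i <;> simp [toE, u₀, u₁]
  -- the thin arc coordinate
  obtain ⟨Λ, hΛ⟩ : ∃ Λ : Circle → ℝ, ∀ a, Λ a = Real.tan (2 / δ * Real.arctan ((a : ℂ).im / (a : ℂ).re)) :=
    ⟨_, fun _ => rfl⟩
  have hΛA : ∀ t, Λ (Circle.exp (δ * Real.arctan t / 2)) = t := fun t => by
    rw [hΛ]; exact tan_arctan_im_div_re_circleExp hδ hδ1 t
  have hΛsm : ∀ t, ContMDiffAt (𝓡 1) 𝓘(ℝ, ℝ) ∞ Λ (Circle.exp (δ * Real.arctan t / 2)) := fun t => by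
    have : Λ = fun a : Circle => Real.tan (2 / δ * Real.arctan ((a : ℂ).im / (a : ℂ).re)) :=
      funext hΛ
    rw [this]
    exact contMDiffAt_thinArcCoord hδ hδ1 t
  -- smoothness of the inverse on the range: patch the local inverses
  have hfinv : ContMDiffOn (𝓡 4) ((𝓡 2).prod (𝓡 2)) ∞ finv (range TT) := by
    rintro _ ⟨⟨w₀, v₀⟩, rfl⟩
    apply ContMDiffAt.contMDiffWithinAt
    set σ₀ : Circle := (Rechart.out f (Circle × Circle) w₀).1 with hσ₀
    -- the local square root and the local inverse
    obtain ⟨Sq, hSq⟩ : ∃ Sq : Circle → Circle, ∀ y, Sq y = σ₀ * Circle.exp (Real.arctan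
        ((((y * (σ₀ ^ 2)⁻¹ : Circle)) : ℂ).im / (((y * (σ₀ ^ 2)⁻¹ : Circle)) : ℂ).re) / 2) :=
      ⟨_, fun _ => rfl⟩
    have hSqσ : ∀ σ' : Circle, 0 < ((σ' * σ₀⁻¹ : Circle) : ℂ).re →
        0 < (((σ' * σ₀⁻¹ : Circle) : ℂ) ^ 2).re → Sq (σ' ^ 2) = σ' := fun σ' h1 h2 => by
      rw [hSq]; exact circle_sqrtNear_sq h1 h2
    obtain ⟨L₀, hL₀⟩ : ∃ L₀ : (Rechart f (Circle × Circle) × Circle) × Circle →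
        Rechart f (Circle × Circle) × EuclideanSpace ℝ (Fin 2), ∀ y,
        L₀ y = (Rechart.into f (Circle × Circle) (Sq y.1.2, y.2),
          toE (Λ (Rechart.out f (Circle × Circle) y.1.1 * (θ (Sq y.1.2))⁻¹).1) (Λ (Rechart.out f (Circle × Circle) y.1.1 * (θ (Sq y.1.2))⁻¹).2)) :=
      ⟨_, fun _ => rfl⟩
    -- the good neighbourhood of `(w₀, v₀)`
    let U₀ : Set (Rechart f (Circle × Circle) × EuclideanSpace ℝ (Fin 2)) :=
      {q | 0 < (((Rechart.out f (Circle × Circle) q.1).1 * σ₀⁻¹ : Circle) : ℂ).re ∧ 0 < ((((Rechart.out f (Circle × Circle) q.1).1 * σ₀⁻¹ : Circle) : ℂ) ^ 2).re}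
    have hU₀o : IsOpen U₀ := by
      have hc : Continuous fun q : Rechart f (Circle × Circle) × EuclideanSpace ℝ (Fin 2) =>
          (Rechart.out f (Circle × Circle) q.1).1 * σ₀⁻¹ :=
        ((continuous_fst.comp (hout.continuous.comp continuous_fst)).mul continuous_const)
      exact isOpen_setOf_re_pos_re_sq_pos.preimage hc
    have hq₀ : ((w₀, v₀) : Rechart f (Circle × Circle) × EuclideanSpace ℝ (Fin 2)) ∈ U₀ := by
      show 0 < (((Rechart.out f (Circle × Circle) w₀).1 * σ₀⁻¹ : Circle) : ℂ).re ∧ 0 < ((((Rechart.out f (Circle × Circle) w₀).1 * σ₀⁻¹ : Circle) : ℂ) ^ 2).re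
      rw [← hσ₀, mul_inv_cancel, Circle.coe_one, one_pow, Complex.one_re]
      exact ⟨one_pos, one_pos⟩
    -- `L₀` inverts `G` on `U₀`
    have hL : ∀ q ∈ U₀, L₀ (G q) = q := by
      rintro ⟨w, v⟩ ⟨h1, h2⟩
      have hS : Sq ((Rechart.out f (Circle × Circle) w).1 ^ 2) = (Rechart.out f (Circle × Circle) w).1 := hSqσ _ h1 h2
      rw [hL₀, hG]
      dsimp only
      rw [hS, Rechart.out_into, mul_inv_cancel_comm, hA]
      dsimp only
      rw [hΛA, hΛA, htoE, Prod.mk.eta, Rechart.into_out]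
    -- `finv = L₀ ∘ e` near `TT (w₀, v₀)`
    have hEq : finv =ᶠ[𝓝 (TT (w₀, v₀))] fun x => L₀ (e x) := by
      filter_upwards [(hopen _ hU₀o).mem_nhds ⟨(w₀, v₀), hq₀, rfl⟩]
      rintro _ ⟨q, hq, rfl⟩
      show finv (TT q) = L₀ (e (e.symm (G q)))
      rw [hleft, e.apply_symm_apply, hL q hq]
    -- `L₀` is smooth at `G (w₀, v₀)`
    have hGpt : G (w₀, v₀) = ((Rechart.into f (Circle × Circle) (θ σ₀ * A v₀), σ₀ ^ 2), (Rechart.out f (Circle × Circle) w₀).2) := by rw [hG]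
    have hSq0 : Sq (σ₀ ^ 2) = σ₀ := hSqσ σ₀ (by rw [mul_inv_cancel, Circle.coe_one, Complex.one_re]; exact one_pos)
      (by rw [mul_inv_cancel, Circle.coe_one, one_pow, Complex.one_re]; exact one_pos)
    have hSqsm : ContMDiffAt (𝓡 1) (𝓡 1) ∞ Sq (σ₀ ^ 2) := by
      have : Sq = fun y : Circle => σ₀ * Circle.exp (Real.arctan
          ((((y * (σ₀ ^ 2)⁻¹ : Circle)) : ℂ).im / (((y * (σ₀ ^ 2)⁻¹ : Circle)) : ℂ).re) / 2) :=
        funext hSq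
      rw [this]
      refine (contMDiffOn_circle_sqrtNear σ₀).contMDiffAt ?_
      refine (isOpen_ne_fun (Complex.continuous_re.comp
        (continuous_subtype_val.comp (continuous_id.mul continuous_const)))
          continuous_const).mem_nhds ?_
      show (((σ₀ ^ 2 * (σ₀ ^ 2)⁻¹ : Circle)) : ℂ).re ≠ 0
      rw [mul_inv_cancel, Circle.coe_one, Complex.one_re]
      exact one_ne_zero
    have hy12 : ContMDiff (((𝓡 2).prod (𝓡 1)).prod (𝓡 1)) (𝓡 1) ∞
        fun y : (Rechart f (Circle × Circle) × Circle) × Circle => y.1.2 :=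
      contMDiff_snd.comp contMDiff_fst
    have hSq' : ContMDiffAt (((𝓡 2).prod (𝓡 1)).prod (𝓡 1)) (𝓡 1) ∞
        (fun y : (Rechart f (Circle × Circle) × Circle) × Circle => Sq y.1.2) (G (w₀, v₀)) := by
      refine ContMDiffAt.comp_of_eq hSqsm hy12.contMDiffAt ?_
      rw [hGpt]
    have hfirst : ContMDiffAt (((𝓡 2).prod (𝓡 1)).prod (𝓡 1)) (𝓡 2) ∞
        (fun y : (Rechart f (Circle × Circle) × Circle) × Circle => Rechart.into f (Circle × Circle) (Sq y.1.2, y.2))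
        (G (w₀, v₀)) :=
      hinto.contMDiffAt.comp _ (hSq'.prodMk contMDiffAt_snd)
    have ha : ContMDiffAt (((𝓡 2).prod (𝓡 1)).prod (𝓡 1)) ((𝓡 1).prod (𝓡 1)) ∞
        (fun y : (Rechart f (Circle × Circle) × Circle) × Circle => Rechart.out f (Circle × Circle) y.1.1 * (θ (Sq y.1.2))⁻¹)
        (G (w₀, v₀)) :=
      (hout.comp (contMDiff_fst.comp contMDiff_fst)).contMDiffAt.mul
        ((contMDiff_theta hκ hθ).contMDiffAt.comp _ hSq').inv
    have ha0 : Rechart.out f (Circle × Circle) (G (w₀, v₀)).1.1 * (θ (Sq (G (w₀, v₀)).1.2))⁻¹ = A v₀ := by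
      rw [hGpt]
      dsimp only
      rw [hSq0, Rechart.out_into, mul_inv_cancel_comm]
    have hΛ1 : ContMDiffAt (((𝓡 2).prod (𝓡 1)).prod (𝓡 1)) 𝓘(ℝ, ℝ) ∞
        (fun y : (Rechart f (Circle × Circle) × Circle) × Circle =>
          Λ (Rechart.out f (Circle × Circle) y.1.1 * (θ (Sq y.1.2))⁻¹).1) (G (w₀, v₀)) := by
      refine ContMDiffAt.comp_of_eq (hΛsm (v₀ 0)) (contMDiffAt_fst.comp _ ha) ?_
      show (Rechart.out f (Circle × Circle) (G (w₀, v₀)).1.1 * (θ (Sq (G (w₀, v₀)).1.2))⁻¹).1 = _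
      rw [ha0, hA]
    have hΛ2 : ContMDiffAt (((𝓡 2).prod (𝓡 1)).prod (𝓡 1)) 𝓘(ℝ, ℝ) ∞
        (fun y : (Rechart f (Circle × Circle) × Circle) × Circle =>
          Λ (Rechart.out f (Circle × Circle) y.1.1 * (θ (Sq y.1.2))⁻¹).2) (G (w₀, v₀)) := by
      refine ContMDiffAt.comp_of_eq (hΛsm (v₀ 1)) (contMDiffAt_snd.comp _ ha) ?_
      show (Rechart.out f (Circle × Circle) (G (w₀, v₀)).1.1 * (θ (Sq (G (w₀, v₀)).1.2))⁻¹).2 = _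
      rw [ha0, hA]
    have hL₀sm : ContMDiffAt (((𝓡 2).prod (𝓡 1)).prod (𝓡 1)) ((𝓡 2).prod (𝓡 2)) ∞ L₀
        (G (w₀, v₀)) := by
      have : L₀ = fun y => (Rechart.into f (Circle × Circle) (Sq y.1.2, y.2),
          toE (Λ (Rechart.out f (Circle × Circle) y.1.1 * (θ (Sq y.1.2))⁻¹).1) (Λ (Rechart.out f (Circle × Circle) y.1.1 * (θ (Sq y.1.2))⁻¹).2)) :=
        funext hL₀
      rw [this]
      exact hfirst.prodMk ((hΛ1.smul contMDiffAt_const).add (hΛ2.smul contMDiffAt_const))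
    have hcomp : ContMDiffAt (𝓡 4) ((𝓡 2).prod (𝓡 2)) ∞ (fun x => L₀ (e x)) (TT (w₀, v₀)) :=
      ContMDiffAt.comp_of_eq hL₀sm he.contMDiffAt (e.apply_symm_apply _)
    exact hcomp.congr_of_eventuallyEq hEq
  -- conclusion
  let L : (EuclideanSpace ℝ (Fin 2) × EuclideanSpace ℝ (Fin 2)) ≃L[ℝ] EuclideanSpace ℝ (Fin 4) :=
    ContinuousLinearEquiv.ofFinrankEq (by simp)
  exact Literature.Geometry.Manifold.isSmoothEmbedding_of_leftInverse_of_isOpenMap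
    (IY := (𝓡 2).prod (𝓡 2)) (I := 𝓡 4) hTTsm hinj hopen hfinv hleft L

end Tube




end BraidedTorus

end Literature.Topology.FourManifolds
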